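/-
Copyright (c) 2026 the pub-hodgecm-mathlib formalisation cell (harness21).  Prover seat hodgecm-mathlib-K2E4-p09 (g2), Track B «K2-LIT» ∕ h413, ‹S› ROAD J, brick (β):
the frame glue of the road-J assembler — the two classes `ε`, `ε′` at the scalar partner, their Kottwitz signs, the compact dock, the class sum.  2026-09-04.
-/
import Literature.NumberTheory.Rogawski1990.LocalTransferCentralSingularCompactPackageCM       -- ★ A-p14: frame imports (`badBlock_herm_and_isUnit_det`, `anisotropic_of_neg_det_not_norm`, `not_exists_neg_det_badBlock_eq_norm`, …)
import Literature.NumberTheory.Rogawski1990.LocalStableClassesNonsplitScalarFrameKappa        -- ★ `finKappaAt_eq_iff_isConj_of_fst_eq_smul_one`, `finExplicitDelta_eq_neg_of_not_isConj_of_fst_eq_smul_one`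
import Literature.NumberTheory.Rogawski1990.LocalStableClassesNonsplitScalarFrameCompactCentralizer  -- ★ `compactSpace_centralizer_of_frame_of_anisotropic`
import Literature.NumberTheory.Rogawski1990.LocalNormFibreDockBlockIsotropic                  -- ★ `exists_neg_det_dockBlock_eq_norm`, `not_exists_neg_det_badBlock_eq_norm`
import Literature.NumberTheory.Rogawski1990.LocalNormFibreBlockDichotomyDock                  -- ★ `coe_dock_mul_dockFrame`
import Literature.NumberTheory.Rogawski1990.LocalNormFibreMatchedCountCM                      -- ★ `badBlock_herm_and_isUnit_det`
import Literature.NumberTheory.Rogawski1990.KottwitzSignTwistedPlane                          -- ★ `kottwitzSign_eq_neg_one_iff_of_frame_finSum`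
import Literature.NumberTheory.Rogawski1990.KottwitzSignCM                                    -- ★ `kottwitzSignLocal`, `kottwitzSignLocal_mk`
import Literature.NumberTheory.Rogawski1990.LocalTransferCentralSingularJunctionCM            -- ★ `isUnit_eval_finCharpolyTwo_of_central`
import Literature.NumberTheory.Rogawski1990.AdelicStableClassesProduct                        -- ★ `isConj_out_conjClasses_mk`
import HarnessLib

/-!
# Road J of ‹S›, the (β) assembler's frame glue: THE TWO CLASSES AT THE SCALAR PARTNER (Rogawski Prop. 3.8.1 (d), Prop. 8.2.1: `γ₀`, `γ₀′`)

Cell `pub/hodgecm-mathlib` (D-0151), Track B «K2-LIT», crux H413 = `stmt-HodgeConjecture-24833`; ‹S› = `sig_K2E3SingularTransferSigned` (E3-owned), ROAD J,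
(J♮) `sig_K2E3SingularTransferLocalGermValue` (cand `K2/K2E4-p06/g2/…` 45a4db33), payer = the (β) assembler `K2E3SingularTransferLocalGermValueOfRoadJ`
(K2E4-plan (g2) 2026-09-04T00:28:50Z (A); K2E4-p09 (g2)).  THEOREMS ONLY (no `def`, no instance, no notation, no `sorry`); lane `--supports stmt-HodgeConjecture-24833 --as helper`.

THIS FILE is the pure local algebra the assembler reads OFF the dock∕bad-frame binders of ★ (α) `…DressValueAtCentreOfEP` (K2E4-p13 p856151) at a NON-SPLIT place `v`
of the CM extension `L ∕ L⁺`: `ε_H = (a·1₂, u) ∈ H_v` central with `u ≠ a`, the central dock `θ : H_v ≃ₜ* Z(ε)` (`(θ z).val = y ι_v(z) y⁻¹`), the swap `W`, the dock frame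
`y·W` with Gram `G₁ ⊕ᶠ G₂` and a bad frame `P′` with Gram `G₁′ ⊕ᶠ G₂′`, `det G₁′ ∉ det G₁ · N`, and the framed second class `ε′` (`ε′ P′ = P′ (a·1₂ ⊕ᶠ u)`).
§1 (section `Frame`):
* `compactSpace_centralizer_secondClass` — (A1) `Z(ε′)` is COMPACT (the bad block `G₁′` is anisotropic: ★ `not_exists_neg_det_badBlock_eq_norm` + ★ `anisotropic_of_neg_det_not_norm`;
  ★ `compactSpace_centralizer_of_frame_of_anisotropic`) — the recipe of ★ A-p14 `exists_compactSidePackage_of_badFrame`, read at (α)'s exported `ε′`;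
* `kottwitzSignLocal_dock_eq_one` — (A2) `e_v(⟦ε⟧) = +1`: the dock block `G₁` is ISOTROPIC (★ `exists_neg_det_dockBlock_eq_norm`), read through ★
  `kottwitzSign_eq_neg_one_iff_of_frame_finSum` on the frame `ε (yW) = (yW)(a·1₂ ⊕ᶠ u)` (★ `coe_dock_mul_dockFrame`);
* `kottwitzSignLocal_secondClass_eq_neg_one` — (A3) `e_v(⟦ε′⟧) = −1` (same reading on `P′`; `−det G₁′` is not a norm);
* `not_isConj_dock_secondClass` — (A4) `ε ≁ ε′` in `G′_v` (`e_v` is a class function with different values);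
* `isConj_dock_or_isConj_secondClass` — (A5) EVERY match `x` of `ε_H` is `G′_v`-conjugate to `ε` or to `ε′`: `κ_v(ε_H, ·) ∈ {±1}` separates the classes
  (★ `finKappaAt_eq_iff_isConj_of_fst_eq_smul_one`, ★ `finKappaAt_eq_neg_of_not_isConj_of_fst_eq_smul_one`, ★ `finKappaAt_eq_one_or_eq_neg_one_of_isUnit`);
* `kottwitzSignLocal_eq_neg_one_iff_not_isConj_dock` — (A6) for a match `x`: `e_v(⟦x⟧) = −1 ↔ x ≁ ε` — the SIGN LAW of (J♮) (`c < 0 ↔` the `e₁`-eigenplane of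
  `(γ₀)_v` is anisotropic, via ★ `aniso_local_iff_kottwitzSignLocal_eq_neg_one` in the assembler);
* `localStableOrbitalIntegral_eq_add` — (A7) at a match `x` of `ε_H`: `Φ^st(x, f) = Φ(⟦ε⟧, f) + Φ(⟦ε′⟧, f)` (the stable class of `x` is `{⟦ε⟧, ⟦ε′⟧}`, `finsum_mem_pair`).
(The matching of the rational κ-block pair `(γ_H)_v → (γ₀)_v` is ★ `K2E4SingularPairIsLocalNormPair.singularPairIsLocalNormPair`, not restated here.)
HONEST LABEL: HC_CM is proved only modulo the 7 printed citations (2 remaining named inputs: hLiu418 = `stmt-HodgeConjecture-24832`, h413 = `stmt-HodgeConjecture-24833`)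
until rung 0 closes; this helper pays no socket by itself.

## References
* [Rogawski1990] J. D. Rogawski, *Automorphic Representations of Unitary Groups in Three Variables*, Ann. of Math. Stud. 123 (1990), §3.8 Prop. 3.8.1 (a)(d) pp. 27–30;
  §4.1 (4.1.2) pp. 39–40; §4.3 (4.3.2) p. 43; §8.1 Prop. 8.1.3 pp. 115–117; §8.2 Prop. 8.2.1 pp. 117–122.
* [Kottwitz1983] R. E. Kottwitz, *Sign changes in harmonic analysis on reductive groups*, Trans. Amer. Math. Soc. 278 (1983), 289–297, §1.
* [Jacobowitz1962] R. Jacobowitz, *Hermitian forms over local fields*, Amer. J. Math. 84 (1962), §3 Thm. 3.1.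
-/

set_option autoImplicit false
set_option linter.dupNamespace false

noncomputable section

open Set Filter Topology NumberField IsDedekindDomain
open Literature.NumberTheory.Automorphic Literature.NumberTheory.GaloisRepresentations
open Literature.NumberTheory.Automorphic.UnitaryGroup hiding hermForm hermForm_apply hermForm_mulVec
open _root_.Matrix hiding mem_unitaryGroup_iff unitaryGroup
open scoped Matrix
open Literature.NumberTheory.Rogawski1990
open Literature.AlgebraicGeometry.ShimuraVarieties (unitaryGroup hermForm)
open scoped MatrixGroups

namespace Summit.HodgeConjecture.HodgeConjecture.Cruxes.H413.K2E3RoadJScalarPartnerClasses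

section Frame

variable (L : Type) [Field L] [NumberField L] [IsCMField L] (H' : Matrix (Fin 3) (Fin 3) L)
  (hherm : (H'.map (cmConjRingHom L))ᵀ = H') (hanis : ∀ x : Fin 3 → L, hermForm (cmConjRingHom L) H' x x = 0 → x = 0)
  (v : HeightOneSpectrum (𝓞 ↥(maximalRealSubfield L))) (hv : Subsingleton (UnitaryGroup.PlacesOver L v))
  (εH : ((UnitaryGroup.cmDatum L 2 (Matrix.of fun i j : Fin 2 => if i.val + j.val + 1 = 2 then (1 : L) else 0)).Local v ×
    (UnitaryGroup.cmDatum L 1 (Matrix.of fun i j : Fin 1 => if i.val + j.val + 1 = 1 then (1 : L) else 0)).Local v))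
  (a : UnitaryGroup.LocalRing L v)
  (ha : (εH.1.val.val : Matrix (Fin 2) (Fin 2) (UnitaryGroup.LocalRing L v)) = a • (1 : Matrix (Fin 2) (Fin 2) (UnitaryGroup.LocalRing L v)))
  (hu : (εH.2.val.val : Matrix (Fin 1) (Fin 1) (UnitaryGroup.LocalRing L v)) 0 0 ≠ a)
  (ε : (UnitaryGroup.cmDatum L 3 H').Local v) (y : GL (Fin 3) (UnitaryGroup.LocalRing L v))
  (θ : ((UnitaryGroup.cmDatum L 2 (Matrix.of fun i j : Fin 2 => if i.val + j.val + 1 = 2 then (1 : L) else 0)).Local v ×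
      (UnitaryGroup.cmDatum L 1 (Matrix.of fun i j : Fin 1 => if i.val + j.val + 1 = 1 then (1 : L) else 0)).Local v) ≃ₜ*
    ↥(Subgroup.centralizer ({ε} : Set ((UnitaryGroup.cmDatum L 3 H').Local v))))
  (hθε : (θ εH).1 = ε)
  (hθ : ∀ z, (((θ z).1).val : GL (Fin 3) (UnitaryGroup.LocalRing L v)) = y * ((endoEmbLocal L v z).val : GL (Fin 3) (UnitaryGroup.LocalRing L v)) * y⁻¹)
  (W : GL (Fin 3) (UnitaryGroup.LocalRing L v)) (hW : W.val = !![(1 : UnitaryGroup.LocalRing L v), 0, 0; 0, 0, 1; 0, 1, 0])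
  (G₁ G₁' : Matrix (Fin 2) (Fin 2) (UnitaryGroup.LocalRing L v)) (G₂ G₂' : Matrix (Fin 1) (Fin 1) (UnitaryGroup.LocalRing L v)) (P' : GL (Fin (2 + 1)) (UnitaryGroup.LocalRing L v))
  (hPW : twistGram (UnitaryGroup.conjLocal L (IsCMField.complexConj L) v) ((UnitaryGroup.adelicForm L 3 H').map (UnitaryGroup.adeleToLocal L v)) (y * W).val = UnitaryGroup.finSum 2 1 G₁ G₂)
  (hP' : twistGram (UnitaryGroup.conjLocal L (IsCMField.complexConj L) v) ((UnitaryGroup.adelicForm L 3 H').map (UnitaryGroup.adeleToLocal L v)) P'.val = UnitaryGroup.finSum 2 1 G₁' G₂')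
  (hnn : ¬ ∃ z : UnitaryGroup.LocalRing L v, IsUnit z ∧ G₁'.det = G₁.det * (UnitaryGroup.conjLocal L (IsCMField.complexConj L) v z * z))
  (ε' : (UnitaryGroup.cmDatum L 3 H').Local v)
  (hε'P : (ε'.val.val : Matrix (Fin 3) (Fin 3) (UnitaryGroup.LocalRing L v)) * P'.val =
    P'.val * UnitaryGroup.finSum 2 1 (a • (1 : Matrix (Fin 2) (Fin 2) (UnitaryGroup.LocalRing L v))) (εH.2.val.val : Matrix (Fin 1) (Fin 1) (UnitaryGroup.LocalRing L v)))

include hherm hanis hv hu hθ hW hPW hP' hnn hε'P in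
/-- **(A1) THE CENTRALISER OF THE SECOND CLASS `ε′` IS COMPACT** (`Z(ε′) ≅ U(G₁′) × U(1)` with the bad block `G₁′` anisotropic: `−det G₁′ ∉ N(L_w^×)`).
[cite: Rogawski1990, §3.8 Prop. 3.8.1 (a)(d) pp. 27–30; §8.2 Prop. 8.2.1 p. 117] [cite: Jacobowitz1962, §3 Thm. 3.1] -/
theorem compactSpace_centralizer_secondClass :
    CompactSpace ↥(Subgroup.centralizer ({ε'} : Set ((UnitaryGroup.cmDatum L 3 H').Local v))) := by
  classical
  obtain ⟨w⟩ := (inferInstance : Nonempty (UnitaryGroup.PlacesOver L v))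
  have hw : IsCMField.complexConj L • w.1 = w.1 := smul_eq_of_subsingleton_placesOver L hv w
  have hdet' : H'.det ≠ 0 := Godement.det_ne_zero_of_anisotropic L H' hanis
  have hHd : IsUnit ((UnitaryGroup.adelicForm L 3 H').map (UnitaryGroup.adeleToLocal L v)).det := UnitaryGroup.isUnit_det_localForm L 3 H' v hdet'
  have h2u : (εH.2.val.val : Matrix (Fin 1) (Fin 1) (UnitaryGroup.LocalRing L v)) = finGammaTwo L v εH • (1 : Matrix (Fin 1) (Fin 1) (UnitaryGroup.LocalRing L v)) := by
    ext i j; fin_cases i; fin_cases j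
    simp [finGammaTwo]
  have hau : IsUnit (a - finGammaTwo L v εH) := isUnit_localRing_of_ne_zero_of_subsingleton L v hv (sub_ne_zero.2 (Ne.symm hu))
  have hε'D : (ε'.val.val : Matrix (Fin 3) (Fin 3) (UnitaryGroup.LocalRing L v)) * P'.val = P'.val * (UnitaryGroup.finSum 2 1 (a • (1 : Matrix (Fin 2) (Fin 2) (UnitaryGroup.LocalRing L v))) (finGammaTwo L v εH • (1 : Matrix (Fin 1) (Fin 1) (UnitaryGroup.LocalRing L v)))) := by
    rw [← h2u]; exact hε'P
  obtain ⟨hG₁', hG₁'d⟩ := badBlock_herm_and_isUnit_det L H' v hherm hdet' hP'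
  have hanis' : ∀ x : Fin 2 → (UnitaryGroup.LocalRing L v), hermForm (UnitaryGroup.conjLocal L (IsCMField.complexConj L) v) G₁' x x = 0 → x = 0 :=
    anisotropic_of_neg_det_not_norm L v w hw hG₁' hG₁'d (not_exists_neg_det_badBlock_eq_norm L H' v w hw hherm hdet' θ hθ hW hPW hnn)
  have hG₂'u : IsUnit (G₂' 0 0) := by
    have hd' : G₁'.det * G₂' 0 0 = (UnitaryGroup.conjLocal L (IsCMField.complexConj L) v) P'.val.det * ((UnitaryGroup.adelicForm L 3 H').map (UnitaryGroup.adeleToLocal L v)).det * P'.val.det := by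
      rw [← Matrix.det_fin_one G₂', ← UnitaryGroup.det_finSum, ← hP', det_twistGram]
    refine isUnit_of_mul_isUnit_right (?_ : IsUnit (G₁'.det * G₂' 0 0))
    rw [hd']
    exact (((Matrix.isUnits_det_units P').map _).mul hHd).mul (Matrix.isUnits_det_units P')
  exact compactSpace_centralizer_of_frame_of_anisotropic L v H' ε' w hw hau hε'D hP' hanis' hG₂'u


include hherm hanis hv ha hu hθε hθ hW hPW in
/-- **(A2) THE DOCK CLASS HAS KOTTWITZ SIGN `+1`**: `e_v(⟦ε⟧) = 1` — the `a`-eigenplane of `ε` in the dock frame `y·W` carries the ISOTROPIC Gram block `G₁` (`−det G₁ ∈ N`).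
[cite: Rogawski1990, §4.1 (4.1.2) pp. 39–40; §8.2 Prop. 8.2.1 p. 117] [cite: Kottwitz1983, §1] -/
theorem kottwitzSignLocal_dock_eq_one : kottwitzSignLocal L 3 H' v (ConjClasses.mk ε) = 1 := by
  classical
  obtain ⟨w⟩ := (inferInstance : Nonempty (UnitaryGroup.PlacesOver L v))
  have hw : IsCMField.complexConj L • w.1 = w.1 := smul_eq_of_subsingleton_placesOver L hv w
  have hdet' : H'.det ≠ 0 := Godement.det_ne_zero_of_anisotropic L H' hanis
  haveI : Algebra.IsQuadraticExtension ↥(maximalRealSubfield L) L := IsCMField.isQuadraticExtension L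
  letI : Field (UnitaryGroup.LocalRing L v) := (LocalRing.isField_of_smul_eq (IsCMField.complexConj L) (IsCMField.complexConj_ne_one L) w hw).toField
  have hHd : IsUnit ((UnitaryGroup.adelicForm L 3 H').map (UnitaryGroup.adeleToLocal L v)).det := UnitaryGroup.isUnit_det_localForm L 3 H' v hdet'
  have h2u : (εH.2.val.val : Matrix (Fin 1) (Fin 1) (UnitaryGroup.LocalRing L v)) = finGammaTwo L v εH • (1 : Matrix (Fin 1) (Fin 1) (UnitaryGroup.LocalRing L v)) := by
    ext i j; fin_cases i; fin_cases j
    simp [finGammaTwo]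
  have hau : IsUnit (a - finGammaTwo L v εH) := isUnit_localRing_of_ne_zero_of_subsingleton L v hv (sub_ne_zero.2 (Ne.symm hu))
  -- the dock frame of `ε`
  have hεD : ((ε.val : GL (Fin 3) (UnitaryGroup.LocalRing L v)).val : Matrix (Fin 3) (Fin 3) (UnitaryGroup.LocalRing L v)) * (y * W).val =
      (y * W).val * UnitaryGroup.finSum 2 1 (a • (1 : Matrix (Fin 2) (Fin 2) (UnitaryGroup.LocalRing L v))) (finGammaTwo L v εH • (1 : Matrix (Fin 1) (Fin 1) (UnitaryGroup.LocalRing L v))) := by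
    have h := coe_dock_mul_dockFrame L H' v θ hθ hW εH
    rw [hθε, ha, h2u] at h
    exact h
  obtain ⟨hG₁, hG₁d⟩ := badBlock_herm_and_isUnit_det L H' v hherm hdet' hPW
  have hG₂u : IsUnit (G₂ 0 0) := by
    have hd' : G₁.det * G₂ 0 0 = (UnitaryGroup.conjLocal L (IsCMField.complexConj L) v) (y * W).val.det * ((UnitaryGroup.adelicForm L 3 H').map (UnitaryGroup.adeleToLocal L v)).det * (y * W).val.det := by
      rw [← Matrix.det_fin_one G₂, ← UnitaryGroup.det_finSum, ← hPW, det_twistGram]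
    refine isUnit_of_mul_isUnit_right (?_ : IsUnit (G₁.det * G₂ 0 0))
    rw [hd']
    exact (((Matrix.isUnits_det_units (y * W)).map _).mul hHd).mul (Matrix.isUnits_det_units (y * W))
  have hiso := exists_neg_det_dockBlock_eq_norm L H' v w hw hherm hdet' θ hθ hW hPW
  have hne : kottwitzSign (UnitaryGroup.conjLocal L (IsCMField.complexConj L) v) ((UnitaryGroup.adelicForm L 3 H').map (UnitaryGroup.adeleToLocal L v))
      ((ε.val : GL (Fin 3) (UnitaryGroup.LocalRing L v)).val : Matrix (Fin 3) (Fin 3) (UnitaryGroup.LocalRing L v)) ≠ -1 := by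
    rw [Ne, kottwitzSign_eq_neg_one_iff_of_frame_finSum (UnitaryGroup.conjLocal L (IsCMField.complexConj L) v) _ (y * W) hau hεD
      (by rw [← twistGram_def]; exact hPW) hG₁ hG₂u.ne_zero, not_not]
    obtain ⟨z, -, hz⟩ := hiso
    exact ⟨z, hz.symm⟩
  rw [kottwitzSignLocal_mk]
  rcases (kottwitzSign_eq_one_or_eq_neg_one _ : kottwitzSign (UnitaryGroup.conjLocal L (IsCMField.complexConj L) v) ((UnitaryGroup.adelicForm L 3 H').map (UnitaryGroup.adeleToLocal L v))
      ((ε.val : GL (Fin 3) (UnitaryGroup.LocalRing L v)).val : Matrix (Fin 3) (Fin 3) (UnitaryGroup.LocalRing L v)) = 1 ∨ _) with h | h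
  · exact h
  · exact absurd h hne

include hherm hanis hv hu hθ hW hPW hP' hnn hε'P in
/-- **(A3) THE SECOND CLASS HAS KOTTWITZ SIGN `−1`**: `e_v(⟦ε′⟧) = −1` — the `a`-eigenplane of `ε′` in the bad frame `P′` carries the ANISOTROPIC block `G₁′` (`−det G₁′ ∉ N`).
[cite: Rogawski1990, §4.1 (4.1.2) pp. 39–40; §8.2 Prop. 8.2.1 p. 117] [cite: Kottwitz1983, §1] -/
theorem kottwitzSignLocal_secondClass_eq_neg_one : kottwitzSignLocal L 3 H' v (ConjClasses.mk ε') = -1 := by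
  classical
  obtain ⟨w⟩ := (inferInstance : Nonempty (UnitaryGroup.PlacesOver L v))
  have hw : IsCMField.complexConj L • w.1 = w.1 := smul_eq_of_subsingleton_placesOver L hv w
  have hdet' : H'.det ≠ 0 := Godement.det_ne_zero_of_anisotropic L H' hanis
  haveI : Algebra.IsQuadraticExtension ↥(maximalRealSubfield L) L := IsCMField.isQuadraticExtension L
  letI : Field (UnitaryGroup.LocalRing L v) := (LocalRing.isField_of_smul_eq (IsCMField.complexConj L) (IsCMField.complexConj_ne_one L) w hw).toField
  have hHd : IsUnit ((UnitaryGroup.adelicForm L 3 H').map (UnitaryGroup.adeleToLocal L v)).det := UnitaryGroup.isUnit_det_localForm L 3 H' v hdet'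
  have h2u : (εH.2.val.val : Matrix (Fin 1) (Fin 1) (UnitaryGroup.LocalRing L v)) = finGammaTwo L v εH • (1 : Matrix (Fin 1) (Fin 1) (UnitaryGroup.LocalRing L v)) := by
    ext i j; fin_cases i; fin_cases j
    simp [finGammaTwo]
  have hau : IsUnit (a - finGammaTwo L v εH) := isUnit_localRing_of_ne_zero_of_subsingleton L v hv (sub_ne_zero.2 (Ne.symm hu))
  have hε'D : ((ε'.val : GL (Fin 3) (UnitaryGroup.LocalRing L v)).val : Matrix (Fin 3) (Fin 3) (UnitaryGroup.LocalRing L v)) * P'.val =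
      P'.val * UnitaryGroup.finSum 2 1 (a • (1 : Matrix (Fin 2) (Fin 2) (UnitaryGroup.LocalRing L v))) (finGammaTwo L v εH • (1 : Matrix (Fin 1) (Fin 1) (UnitaryGroup.LocalRing L v))) := by
    rw [← h2u]; exact hε'P
  obtain ⟨hG₁', hG₁'d⟩ := badBlock_herm_and_isUnit_det L H' v hherm hdet' hP'
  have hG₂'u : IsUnit (G₂' 0 0) := by
    have hd' : G₁'.det * G₂' 0 0 = (UnitaryGroup.conjLocal L (IsCMField.complexConj L) v) P'.val.det * ((UnitaryGroup.adelicForm L 3 H').map (UnitaryGroup.adeleToLocal L v)).det * P'.val.det := by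
      rw [← Matrix.det_fin_one G₂', ← UnitaryGroup.det_finSum, ← hP', det_twistGram]
    refine isUnit_of_mul_isUnit_right (?_ : IsUnit (G₁'.det * G₂' 0 0))
    rw [hd']
    exact (((Matrix.isUnits_det_units P').map _).mul hHd).mul (Matrix.isUnits_det_units P')
  have hnn' := not_exists_neg_det_badBlock_eq_norm L H' v w hw hherm hdet' θ hθ hW hPW hnn
  rw [kottwitzSignLocal_mk, kottwitzSign_eq_neg_one_iff_of_frame_finSum (UnitaryGroup.conjLocal L (IsCMField.complexConj L) v) _ P' hau hε'D
    (by rw [← twistGram_def]; exact hP') hG₁' hG₂'u.ne_zero]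
  rintro ⟨z, hz⟩
  refine hnn' ⟨z, ?_, hz.symm⟩
  have hz0 : z ≠ 0 := by
    intro h0
    rw [h0, mul_zero] at hz
    exact hG₁'d.ne_zero (neg_eq_zero.1 hz.symm)
  exact isUnit_iff_ne_zero.2 hz0

include hherm hanis hv ha hu hθε hθ hW hPW hP' hnn hε'P in
/-- **(A4) `ε ≁ ε′` IN `G′_v`** (the Kottwitz sign is a class function and takes different values on them). [cite: Rogawski1990, §3.8 Prop. 3.8.1 (d) p. 30; §8.2 Prop. 8.2.1 p. 117] -/
theorem not_isConj_dock_secondClass : ¬ IsConj ε ε' := by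
  intro h
  have h1 := kottwitzSignLocal_dock_eq_one L H' hherm hanis v hv εH a ha hu ε y θ hθε hθ W hW G₁ G₂ hPW
  have h2 := kottwitzSignLocal_secondClass_eq_neg_one L H' hherm hanis v hv εH a hu ε y θ hθ W hW G₁ G₁' G₂ G₂' P' hPW hP' hnn ε' hε'P
  rw [ConjClasses.mk_eq_mk_iff_isConj.2 h, h2] at h1
  exact absurd h1 (by decide)


include hherm hanis hv ha hu hθε hθ hW hPW hP' hnn hε'P in
/-- **(A5) THE TWO CLASSES EXHAUST THE MATCHES OF `ε_H`**: every `x ∈ G′_v` matched with `ε_H` is `G′_v`-conjugate to `ε` or to `ε′` — `κ_v(ε_H, ·) = ±1` separates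
the conjugacy classes inside the stable class (★ `finKappaAt_eq_iff_isConj_of_fst_eq_smul_one`) and `κ_v(ε_H, ε′) = −κ_v(ε_H, ε)`.
[cite: Rogawski1990, §3.8 Prop. 3.8.1 (d) p. 30; §4.3 (4.3.2) p. 43; §8.2 Prop. 8.2.1 (a)(d) pp. 118–122] -/
theorem isConj_dock_or_isConj_secondClass (hmε : IsLocalNormPair L H' v εH ε) (hmatch : IsLocalNormPair L H' v εH ε')
    (x : (UnitaryGroup.cmDatum L 3 H').Local v) (hx : IsLocalNormPair L H' v εH x) : IsConj ε x ∨ IsConj ε' x := by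
  classical
  obtain ⟨w⟩ := (inferInstance : Nonempty (UnitaryGroup.PlacesOver L v))
  have hw : IsCMField.complexConj L • w.1 = w.1 := smul_eq_of_subsingleton_placesOver L hv w
  have hdet' : H'.det ≠ 0 := Godement.det_ne_zero_of_anisotropic L H' hanis
  have hHd : IsUnit ((UnitaryGroup.adelicForm L 3 H').map (UnitaryGroup.adeleToLocal L v)).det := UnitaryGroup.isUnit_det_localForm L 3 H' v hdet'
  have hH := UnitaryGroup.map_conjLocal_transpose_localForm L 3 H' v hherm
  have hu₀ : IsUnit ((finCharpolyTwo L v εH).eval (finGammaTwo L v εH)) := isUnit_eval_finCharpolyTwo_of_central L v w hw εH a ha hu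
  have key : ∀ b b' : (UnitaryGroup.cmDatum L 3 H').Local v,
      IsConj (⟨b.val, b.2⟩ : unitaryGroup (UnitaryGroup.conjLocal L (IsCMField.complexConj L) v) ((UnitaryGroup.adelicForm L 3 H').map (UnitaryGroup.adeleToLocal L v))) ⟨b'.val, b'.2⟩ ↔
        IsConj b b' := fun _ _ => Iff.rfl
  have hεε' : ¬ IsConj (⟨ε.val, ε.2⟩ : unitaryGroup (UnitaryGroup.conjLocal L (IsCMField.complexConj L) v) ((UnitaryGroup.adelicForm L 3 H').map (UnitaryGroup.adeleToLocal L v))) ⟨ε'.val, ε'.2⟩ := by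
    rw [key]
    exact not_isConj_dock_secondClass L H' hherm hanis v hv εH a ha hu ε y θ hθε hθ W hW G₁ G₁' G₂ G₂' P' hPW hP' hnn ε' hε'P
  have hκε' : finKappaAt L v H' εH ε' = -finKappaAt L v H' εH ε :=
    finKappaAt_eq_neg_of_not_isConj_of_fst_eq_smul_one L v H' εH ε ε' w hw hmε hmatch hu₀ hH hHd ha hεε'
  by_cases hκ : finKappaAt L v H' εH x = finKappaAt L v H' εH ε
  · exact Or.inl ((key ε x).1 ((finKappaAt_eq_iff_isConj_of_fst_eq_smul_one L v H' εH ε x w hw hmε hx hu₀ hH hHd ha).1 hκ))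
  · refine Or.inr ((key ε' x).1 ((finKappaAt_eq_iff_isConj_of_fst_eq_smul_one L v H' εH ε' x w hw hmatch hx hu₀ hH hHd ha).1 ?_))
    rw [hκε']
    rcases finKappaAt_eq_one_or_eq_neg_one_of_isUnit L v H' εH x hx hu₀ with hκx | hκx <;>
      rcases finKappaAt_eq_one_or_eq_neg_one_of_isUnit L v H' εH ε hmε hu₀ with hκe | hκe
    · exact absurd (hκx.trans hκe.symm) hκ
    · rw [hκx, hκe]; norm_num
    · rw [hκx, hκe]
    · exact absurd (hκx.trans hκe.symm) hκ

include hherm hanis hv ha hu hθε hθ hW hPW hP' hnn hε'P in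
/-- **(A6) THE SIGN LAW**: for a match `x` of `ε_H`, `e_v(⟦x⟧) = −1` iff `x` is NOT `G′_v`-conjugate to the dock point `ε` (iff it is conjugate to `ε′`).
[cite: Rogawski1990, §4.1 (4.1.2) pp. 39–40; §8.2 Prop. 8.2.1 p. 117] [cite: Kottwitz1983, §1] -/
theorem kottwitzSignLocal_eq_neg_one_iff_not_isConj_dock (hmε : IsLocalNormPair L H' v εH ε) (hmatch : IsLocalNormPair L H' v εH ε')
    (x : (UnitaryGroup.cmDatum L 3 H').Local v) (hx : IsLocalNormPair L H' v εH x) :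
    kottwitzSignLocal L 3 H' v (ConjClasses.mk x) = -1 ↔ ¬ IsConj ε x := by
  have h1 := kottwitzSignLocal_dock_eq_one L H' hherm hanis v hv εH a ha hu ε y θ hθε hθ W hW G₁ G₂ hPW
  have h2 := kottwitzSignLocal_secondClass_eq_neg_one L H' hherm hanis v hv εH a hu ε y θ hθ W hW G₁ G₁' G₂ G₂' P' hPW hP' hnn ε' hε'P
  constructor
  · intro hx1 hc
    rw [← ConjClasses.mk_eq_mk_iff_isConj.2 hc, h1] at hx1
    exact absurd hx1 (by decide)
  · intro hc
    rcases isConj_dock_or_isConj_secondClass L H' hherm hanis v hv εH a ha hu ε y θ hθε hθ W hW G₁ G₁' G₂ G₂' P' hPW hP' hnn ε' hε'P hmε hmatch x hx with h | h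
    · exact absurd h hc
    · rw [← ConjClasses.mk_eq_mk_iff_isConj.2 h, h2]


include hherm hanis hv ha hu hθε hθ hW hPW hP' hnn hε'P in
/-- **(A7) THE STABLE ORBITAL INTEGRAL AT THE κ-BLOCK IS A TWO-TERM SUM**: for a match `x` of `ε_H`, `Φ^st(x, f) = Φ(⟦ε⟧, f) + Φ(⟦ε′⟧, f)` for EVERY orbital measure family
(the stable class of `x` in `G′_v` is `{⟦ε⟧, ⟦ε′⟧}`). [cite: Rogawski1990, §4.1 (4.1.1) p. 39; §8.2 Prop. 8.2.1 pp. 117–118 («`Φ(γ₀, f) + Φ(γ₀′, f)`»)] -/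
theorem localStableOrbitalIntegral_eq_add (hmε : IsLocalNormPair L H' v εH ε) (hmatch : IsLocalNormPair L H' v εH ε')
    (x : (UnitaryGroup.cmDatum L 3 H').Local v) (hx : IsLocalNormPair L H' v εH x)
    [∀ γ : (UnitaryGroup.cmDatum L 3 H').Local v, MeasurableSpace ((UnitaryGroup.cmDatum L 3 H').Local v ⧸ Subgroup.centralizer ({γ} : Set ((UnitaryGroup.cmDatum L 3 H').Local v)))]
    (m : OrbitalMeasureFamily ((UnitaryGroup.cmDatum L 3 H').Local v)) (f : (UnitaryGroup.cmDatum L 3 H').Local v → ℂ) :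
    localStableOrbitalIntegral L 3 H' v m f x = classOrbitalIntegral m f (ConjClasses.mk ε) + classOrbitalIntegral m f (ConjClasses.mk ε') := by
  classical
  have hne : ConjClasses.mk ε ≠ ConjClasses.mk ε' := fun h =>
    not_isConj_dock_secondClass L H' hherm hanis v hv εH a ha hu ε y θ hθε hθ W hW G₁ G₁' G₂ G₂' P' hPW hP' hnn ε' hε'P (ConjClasses.mk_eq_mk_iff_isConj.1 h)
  have hmk : ∀ c : ConjClasses ((UnitaryGroup.cmDatum L 3 H').Local v), ConjClasses.mk (Quotient.out c) = c := fun c => by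
    rw [← ConjClasses.quotient_mk_eq_mk, Quotient.out_eq]
  have hS : {c : ConjClasses ((UnitaryGroup.cmDatum L 3 H').Local v) |
      IsStablyConj (UnitaryGroup.conjLocal L (IsCMField.complexConj L) v) ((UnitaryGroup.adelicForm L 3 H').map (UnitaryGroup.adeleToLocal L v)) x (Quotient.out c)} =
      {ConjClasses.mk ε, ConjClasses.mk ε'} := by
    ext c
    simp only [Set.mem_setOf_eq, Set.mem_insert_iff, Set.mem_singleton_iff]
    constructor
    · intro hc
      have hxc : IsLocalNormPair L H' v εH (Quotient.out c) := Corresponds.of_isStablyConj_right hx hc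
      rcases isConj_dock_or_isConj_secondClass L H' hherm hanis v hv εH a ha hu ε y θ hθε hθ W hW G₁ G₁' G₂ G₂' P' hPW hP' hnn ε' hε'P hmε hmatch
          (Quotient.out c) hxc with h | h
      · exact Or.inl (by rw [← hmk c, ← ConjClasses.mk_eq_mk_iff_isConj.2 h])
      · exact Or.inr (by rw [← hmk c, ← ConjClasses.mk_eq_mk_iff_isConj.2 h])
    · rintro (rfl | rfl)
      · exact ((IsConj.symm hx).trans hmε).trans (isStablyConj_of_isConj (isConj_out_conjClasses_mk ε))
      · exact ((IsConj.symm hx).trans hmatch).trans (isStablyConj_of_isConj (isConj_out_conjClasses_mk ε'))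
  have key := finsum_mem_pair (f := fun c => classOrbitalIntegral m f c) hne
  rw [← hS] at key
  exact key

end Frame

end Summit.HodgeConjecture.HodgeConjecture.Cruxes.H413.K2E3RoadJScalarPartnerClasses

end
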